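import Literature.MathematicalPhysics.QuantumLattice.DWaveSourceCanonicalClassChargedRows
import HarnessLib

/-!
# Canonical-class sourced window certificates with a CHARGED `kkt` block in envelope form

Topic `Literature/MathematicalPhysics/QuantumLattice` (namespace = path); cell `hubbard-cq`, seat `hubbard-cq-obsth-1`
(row «pinning-field K5 menu nodes with the pinning term»). `DWaveSourceCanonicalClassWindowCertificate` reads the `μ = 0` sourced
identity with NUMBER-CONSERVING ground-state rows on the canonical class; `DWaveSourceCanonicalClassChargedRows` licenses, on the same
class, a `kkt` block on a family of ONE definite charge in ENVELOPE form (`kktForm H₀ G' C̃k + (q μ̄) • gramForm G' C̃k` with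
`μ̄ = (u₊ − ℓ)/δ` from a canonical cap node at density `ρ + δ` and an E-leg floor `ℓ` at `ρ`). This file puts the two together:

* `IsTranslationInvariant.re_sum_twistedFlipAct_expect_ge_of_sourced_certificate_kkt_canonical_chargeLowering` — the orbit form with
  ONE extra block `kktForm H₀ G' (Γ ∘ Ck) + ((q · (u₊ − ℓ)/δ : ℝ) : ℂ) • gramForm G' (Γ ∘ Ck)` on the right-hand side (`Ck_b ∈ 𝔄_Λ`
  lowering the particle number by `q ≥ 0`, e.g. singlet pair annihilators `q = 2` — the pair channel of a Nambu-type block taken by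
  itself): `c − Σ‖aₖ‖ + (Σ_σ μ_σ)(ρ/2 − ν) ≤ (1/32) Σ_g Re (α_g ω)(Xw)` for every density-`ρ` minimiser `ω` of `e^{src}_{0,h}`; each
  flip-twisted transform of `ω` is again a density-`ρ` minimiser, to which the envelope row applies with the SAME data.
* `IsTranslationInvariant.le_two_mul_re_expect_localPairAt_of_twistedFlip_certificate_kkt_canonical_chargeLowering` — the K-leg MIN
  node shape with the charged block: `… ≤ 2 Re ω(P₀^d)` on the density-`ρ` minimisers.

HONEST FRAMING (cell hubbard-cq): soundness theorems; no certificate, no number, no order parameter, no phase word. The envelope is as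
wide as the cell's canonical caps/floors at `ρ ± δ` make it; a Nambu-MIXED block (no common charge) and charged `eom` rows remain
unlicensed on this class. Everything is PROVED; no definition, no named fact, no `sorry`. Tree search: `lean search 'canonical_charge'` —
nothing; REUSED `re_sum_twistedFlipAct_expect_ge_of_sourced_certificate_kkt_canonical`, `twistedFlipAct_canonicalMinimiser`,
`canonicalMinimiser_re_expect_kktForm_add_mul_nonneg_of_chargeLowering`.

References: O. Bratteli, D. W. Robinson, *OAQSM 2* (1997) Prop. 5.3.19 [cite: BratteliRobinsonII1997, Prop. 5.3.19];
O. Bratteli, A. Kishimoto, D. W. Robinson, CMP 64 (1978) 41, Thm. 2 [cite: BratteliKishimotoRobinson1978, Thm. 2];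
M. Araújo et al., arXiv:2311.18707 §3.2 Prop. 11 [cite: AraujoEtAl2023, §3.2 Prop. 11]; J. Wang et al., PRX 14 (2024) 031006 §III
[cite: WangEtAl2024, §III]; T. Koma, H. Tasaki, J. Stat. Phys. 76 (1994) 745 §1 [cite: KomaTasaki1994, §1].
-/

noncomputable section

namespace Literature.MathematicalPhysics.QuantumLattice

open Matrix Finset Complex HubbardWave0 Literature.Probability.LatticeModels Set
open Literature.MathematicalPhysics.QuantumManyBody.StateRelaxation
open scoped ComplexOrder BigOperators

namespace InfVolFermionState

variable {ω : InfVolFermionState 2} {t' U h ρ : ℝ}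

/-- **The charged envelope block has nonnegative expectation on every density-`ρ` minimiser**:
`0 ≤ Re ω(kktForm H₀ G' C̃k + (q (u₊ − ℓ)/δ) • gramForm G' C̃k)`. [cite: BratteliRobinsonII1997, Prop. 5.3.19] [cite: Ruelle1969, §3.4] -/
theorem re_expect_chargeLoweringBlock_nonneg_of_canonicalMinimiser (hω : ω.IsTranslationInvariant) (hρ : ω.density = ρ)
    (hρ0 : 0 < ρ) (hρ2 : ρ < 2)
    (hmin : ∀ σ : InfVolFermionState 2, σ.IsTranslationInvariant → σ.density = ρ →
      ω.meanEnergy (hubbardTTPrimeSourcedInteraction 1 t' U 0 dWaveFormFactor h) 1 ≤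
        σ.meanEnergy (hubbardTTPrimeSourcedInteraction 1 t' U 0 dWaveFormFactor h) 1)
    {ℓ uP δ q : ℝ} (hδ : 0 < δ) (hq : 0 ≤ q)
    (hfloor : ∀ σ : InfVolFermionState 2, σ.IsTranslationInvariant → σ.density = ρ →
      ℓ ≤ σ.meanEnergy (hubbardTTPrimeSourcedInteraction 1 t' U 0 dWaveFormFactor h) 1)
    (hcap : ∃ σ : InfVolFermionState 2, σ.IsTranslationInvariant ∧ σ.density = ρ + δ ∧
      σ.meanEnergy (hubbardTTPrimeSourcedInteraction 1 t' U 0 dWaveFormFactor h) 1 ≤ uP)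
    {Λ Λ' : Finset (Site 2)} (hΛ : Λ ⊆ Λ') (h8 : thicken Λ 1 ⊆ Λ') {β' : Type*} [Fintype β'] [DecidableEq β']
    {G' : Matrix β' β' ℂ} (hG' : G'.PosSemidef) (Ck : β' → FermionOp Λ)
    (hCk : ∀ b, (totalNumber : FermionOp Λ) * Ck b - Ck b * totalNumber = -((q : ℂ) • Ck b)) :
    0 ≤ (ω.expect Λ' (kktForm (pairSourceWindowHamiltonianTT' dWaveFormFactor Λ' t' U 0 h) G'
          (fun b => fermionEmbed (PolySite.incl hΛ) (Ck b)) +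
        ((q * ((uP - ℓ) / δ) : ℝ) : ℂ) • gramForm G' (fun b => fermionEmbed (PolySite.incl hΛ) (Ck b)))).re := by
  have h := canonicalMinimiser_re_expect_kktForm_add_mul_nonneg_of_chargeLowering hω hρ hρ0 hρ2 hmin hδ hq hfloor hcap hΛ h8 hG' Ck
    hCk
  rw [map_add, map_smul, Complex.add_re, smul_eq_mul, Complex.re_ofReal_mul]
  exact h

/-- **Canonical-class reader with a charge-LOWERING `kkt` block in envelope form.** The identity of
`DWaveSourceCanonicalClassWindowCertificate` §2 (`μ = 0`; filling rows; cap row on `ω`; unsourced floor row on the class; number-conserving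
`eom` block over `s` and `kkt` block `kktForm H₀ G B̃k`; flip-twisted defects; anti-Hermitian rows; residual words) with ONE more block
`kktForm H₀ G' C̃k + ((q (u₊ − ℓ)/δ : ℝ) : ℂ) • gramForm G' C̃k` (`Ck_b ∈ 𝔄_Λ` lowering the particle number by `q ≥ 0`, `G' ⪰ 0`; `ℓ` an E-leg
floor at density `ρ`, `u₊` a canonical cap at `ρ + δ`) gives `c − Σ‖aₖ‖ + (Σ_σ μ_σ)(ρ/2 − ν) ≤ (1/32) Σ_g Re (α_g ω)(Xw)` for every
density-`ρ` minimiser `ω` of `e^{src}_{0,h}`. [cite: WangEtAl2024, §III] [cite: BratteliRobinsonII1997, Prop. 5.3.19]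
[cite: BratteliKishimotoRobinson1978, Thm. 2] [cite: AraujoEtAl2023, §3.2 Prop. 11] -/
theorem IsTranslationInvariant.re_sum_twistedFlipAct_expect_ge_of_sourced_certificate_kkt_canonical_chargeLowering
    (hω : ω.IsTranslationInvariant) (hρ : ω.density = ρ) (hρ0 : 0 < ρ) (hρ2 : ρ < 2)
    (hmin : ∀ σ : InfVolFermionState 2, σ.IsTranslationInvariant → σ.density = ρ →
      ω.meanEnergy (hubbardTTPrimeSourcedInteraction 1 t' U 0 dWaveFormFactor h) 1 ≤
        σ.meanEnergy (hubbardTTPrimeSourcedInteraction 1 t' U 0 dWaveFormFactor h) 1)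
    {Λ Λ' : Finset (Site 2)} (hΛ : Λ ⊆ Λ') (h8 : thicken Λ 1 ⊆ Λ') (h0 : thicken ({0} : Finset (Site 2)) 1 ⊆ Λ')
    (hz : (0 : Site 2) ∈ Λ')
    (Xw : FermionOp Λ') (κp κm u lo : ℝ) (μc : Fin 2 → ℝ) (ν : ℝ)
    (hcap : κp * ω.meanEnergy (hubbardTTPrimeSourcedInteraction 1 t' U 0 dWaveFormFactor h) 1 ≤ κp * u)
    (hlo : ∀ σ : InfVolFermionState 2, σ.IsTranslationInvariant → σ.density = ω.density →
      κm * lo ≤ κm * σ.meanEnergy (hubbardTTPrimeFermionInteraction 1 t' U) 1)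
    {ℓ uP δ q : ℝ} (hδ : 0 < δ) (hq : 0 ≤ q)
    (hfloor : ∀ σ : InfVolFermionState 2, σ.IsTranslationInvariant → σ.density = ρ →
      ℓ ≤ σ.meanEnergy (hubbardTTPrimeSourcedInteraction 1 t' U 0 dWaveFormFactor h) 1)
    (hcapP : ∃ σ : InfVolFermionState 2, σ.IsTranslationInvariant ∧ σ.density = ρ + δ ∧
      σ.meanEnergy (hubbardTTPrimeSourcedInteraction 1 t' U 0 dWaveFormFactor h) 1 ≤ uP)
    {m : Type*} [Fintype m] [DecidableEq m] {Λm : Matrix m m ℂ} (hΛm : Λm.PosSemidef) (O : m → FermionOp Λ')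
    {κ' : Type*} (s : Finset κ') (B : κ' → FermionOp Λ) (hB : ∀ k ∈ s, Commute (totalNumber : FermionOp Λ) (B k))
    {ι : Type*} (tt : Finset ι) (γ : ι → DihedralGroup 4) (wv : ι → Site 2) (fl mt : ι → Fin 2)
    (hsh : ∀ l, d4ShiftSet (γ l) (wv l) Λ ⊆ Λ') (bb : ι → ℂ) (yw : ι → List (Orb (PolySite Λ) × Bool))
    {δ' : Type*} (ah : Finset δ') (dc : δ' → ℝ) (V : δ' → FermionOp Λ')
    {κ'' : Type*} (w : Finset κ'') (a : κ'' → ℂ) (word : κ'' → List (Orb (PolySite Λ') × Bool))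
    {β : Type*} [Fintype β] [DecidableEq β] {G : Matrix β β ℂ} (hG : G.PosSemidef) (Bk : β → FermionOp Λ)
    (hBk : ∀ b, Commute (totalNumber : FermionOp Λ) (Bk b))
    {β' : Type*} [Fintype β'] [DecidableEq β'] {G' : Matrix β' β' ℂ} (hG' : G'.PosSemidef) (Ck : β' → FermionOp Λ)
    (hCk : ∀ b, (totalNumber : FermionOp Λ) * Ck b - Ck b * totalNumber = -((q : ℂ) • Ck b)) {c : ℝ}
    (hcert : Xw - (c : ℂ) • (1 : FermionOp Λ') -
        ∑ σ : Fin 2, ((μc σ : ℝ) : ℂ) • (nAt 0 hz σ - ((ν : ℝ) : ℂ) • (1 : FermionOp Λ')) -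
        ((κp : ℝ) : ℂ) • (((u : ℝ) : ℂ) • (1 : FermionOp Λ') -
          fermionEmbed (PolySite.incl h0) ((hubbardTTPrimeSourcedInteraction 1 t' U 0 dWaveFormFactor h).meanEnergyObs 1)) -
        ((κm : ℝ) : ℂ) • (fermionEmbed (PolySite.incl h0) ((hubbardTTPrimeFermionInteraction 1 t' U).meanEnergyObs 1) -
          ((lo : ℝ) : ℂ) • (1 : FermionOp Λ')) =
      gramForm Λm O +
        (∑ k ∈ s, (pairSourceWindowHamiltonianTT' dWaveFormFactor Λ' t' U 0 h * fermionEmbed (PolySite.incl hΛ) (B k) -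
            fermionEmbed (PolySite.incl hΛ) (B k) * pairSourceWindowHamiltonianTT' dWaveFormFactor Λ' t' U 0 h) +
          ∑ l ∈ tt, bb l • (gaugePhase (twistFlipExp (γ l) (fl l) (mt l)) (yw l) •
              fermionEmbed (PolySite.incl (hsh l))
                (fermionEmbed (PolySite.d4Emb (γ l) (wv l) Λ) (spinSwapIter (fl l).val (ladderWord (yw l)))) -
            fermionEmbed (PolySite.incl hΛ) (ladderWord (yw l)))) +
        (∑ m' ∈ ah, ((dc m' : ℝ) : ℂ) • ((V m')ᴴ - V m') + ∑ k ∈ w, a k • ladderWord (word k)) +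
        kktForm (pairSourceWindowHamiltonianTT' dWaveFormFactor Λ' t' U 0 h) G
          (fun b' => fermionEmbed (PolySite.incl hΛ) (Bk b')) +
        (kktForm (pairSourceWindowHamiltonianTT' dWaveFormFactor Λ' t' U 0 h) G'
            (fun b' => fermionEmbed (PolySite.incl hΛ) (Ck b')) +
          ((q * ((uP - ℓ) / δ) : ℝ) : ℂ) • gramForm G' (fun b' => fermionEmbed (PolySite.incl hΛ) (Ck b')))) :
    c - ∑ k ∈ w, ‖a k‖ + (∑ σ : Fin 2, μc σ) * (ω.density / 2 - ν) ≤
      (∑ g : TwistFlipIndex, ((ω.twistedFlipAct g).expect Λ' Xw).re) / 32 := by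
  set Q : FermionOp Λ' := kktForm (pairSourceWindowHamiltonianTT' dWaveFormFactor Λ' t' U 0 h) G'
      (fun b' => fermionEmbed (PolySite.incl hΛ) (Ck b')) +
    ((q * ((uP - ℓ) / δ) : ℝ) : ℂ) • gramForm G' (fun b' => fermionEmbed (PolySite.incl hΛ) (Ck b')) with hQ
  set N : FermionOp Λ' := ∑ σ : Fin 2, ((μc σ : ℝ) : ℂ) • (nAt 0 hz σ - ((ν : ℝ) : ℂ) • (1 : FermionOp Λ')) with hN
  set Cp : FermionOp Λ' := ((κp : ℝ) : ℂ) • (((u : ℝ) : ℂ) • (1 : FermionOp Λ') -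
    fermionEmbed (PolySite.incl h0) ((hubbardTTPrimeSourcedInteraction 1 t' U 0 dWaveFormFactor h).meanEnergyObs 1)) with hCp
  set Cm : FermionOp Λ' := ((κm : ℝ) : ℂ) • (fermionEmbed (PolySite.incl h0)
    ((hubbardTTPrimeFermionInteraction 1 t' U).meanEnergyObs 1) - ((lo : ℝ) : ℂ) • (1 : FermionOp Λ')) with hCm
  set RHS : FermionOp Λ' := gramForm Λm O +
        (∑ k ∈ s, (pairSourceWindowHamiltonianTT' dWaveFormFactor Λ' t' U 0 h * fermionEmbed (PolySite.incl hΛ) (B k) -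
            fermionEmbed (PolySite.incl hΛ) (B k) * pairSourceWindowHamiltonianTT' dWaveFormFactor Λ' t' U 0 h) +
          ∑ l ∈ tt, bb l • (gaugePhase (twistFlipExp (γ l) (fl l) (mt l)) (yw l) •
              fermionEmbed (PolySite.incl (hsh l))
                (fermionEmbed (PolySite.d4Emb (γ l) (wv l) Λ) (spinSwapIter (fl l).val (ladderWord (yw l)))) -
            fermionEmbed (PolySite.incl hΛ) (ladderWord (yw l)))) +
        (∑ m' ∈ ah, ((dc m' : ℝ) : ℂ) • ((V m')ᴴ - V m') + ∑ k ∈ w, a k • ladderWord (word k)) +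
        kktForm (pairSourceWindowHamiltonianTT' dWaveFormFactor Λ' t' U 0 h) G
          (fun b' => fermionEmbed (PolySite.incl hΛ) (Bk b')) with hRHS
  have hcert' : (Xw - Q) - (c : ℂ) • (1 : FermionOp Λ') - N - Cp - Cm = RHS := by
    have h1 : (Xw - Q) - (c : ℂ) • (1 : FermionOp Λ') - N - Cp - Cm = Xw - (c : ℂ) • (1 : FermionOp Λ') - N - Cp - Cm - Q := by
      abel
    rw [h1, hcert]
    abel
  have hmain := hω.re_sum_twistedFlipAct_expect_ge_of_sourced_certificate_kkt_canonical hρ hρ0 hρ2 hmin hΛ h8 h0 hz (Xw - Q) κp κm u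
    lo μc ν hcap hlo hΛm O s B hB tt γ wv fl mt hsh bb yw ah dc V w a word hG Bk hBk hcert'
  have hg : ∀ g : TwistFlipIndex, ((ω.twistedFlipAct g).expect Λ' (Xw - Q)).re ≤ ((ω.twistedFlipAct g).expect Λ' Xw).re := by
    intro g
    obtain ⟨hTg, hρg, hming⟩ := hω.twistedFlipAct_canonicalMinimiser hρ hmin g
    have hQg : 0 ≤ ((ω.twistedFlipAct g).expect Λ' Q).re :=
      re_expect_chargeLoweringBlock_nonneg_of_canonicalMinimiser hTg hρg hρ0 hρ2 hming hδ hq hfloor hcapP hΛ h8 hG' Ck hCk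
    rw [map_sub, Complex.sub_re]
    linarith
  have hsum := Finset.sum_le_sum fun g (_ : g ∈ (Finset.univ : Finset TwistFlipIndex)) => hg g
  exact hmain.trans (div_le_div_of_nonneg_right hsum (by norm_num))

/-- **K-LEG MIN with a charged block, canonical class** (`Xw = +(Γ P₀^d + (Γ P₀^d)ᴴ)`): the identity above proves
`c − Σ‖aₖ‖ + (Σ_σ μ_σ)(ρ/2 − ν) ≤ 2 Re ω(P₀^d)` for every density-`ρ` minimiser `ω` of `e^{src}_{0,h}` — a finite-`h` RESPONSE floor on the
canonical ground states. [cite: KomaTasaki1994, §1] [cite: WangEtAl2024, §III] -/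
theorem IsTranslationInvariant.le_two_mul_re_expect_localPairAt_of_twistedFlip_certificate_kkt_canonical_chargeLowering
    (hω : ω.IsTranslationInvariant) (hρ : ω.density = ρ) (hρ0 : 0 < ρ) (hρ2 : ρ < 2)
    (hmin : ∀ σ : InfVolFermionState 2, σ.IsTranslationInvariant → σ.density = ρ →
      ω.meanEnergy (hubbardTTPrimeSourcedInteraction 1 t' U 0 dWaveFormFactor h) 1 ≤
        σ.meanEnergy (hubbardTTPrimeSourcedInteraction 1 t' U 0 dWaveFormFactor h) 1)
    {Λ Λ' : Finset (Site 2)} (hΛ : Λ ⊆ Λ') (h8 : thicken Λ 1 ⊆ Λ') (h0 : thicken ({0} : Finset (Site 2)) 1 ⊆ Λ')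
    (hz : (0 : Site 2) ∈ Λ') (hP : pairRegion (insert (0 : Site 2) unitSteps) 0 ⊆ Λ')
    (κp κm u lo : ℝ) (μc : Fin 2 → ℝ) (ν : ℝ)
    (hcap : κp * ω.meanEnergy (hubbardTTPrimeSourcedInteraction 1 t' U 0 dWaveFormFactor h) 1 ≤ κp * u)
    (hlo : ∀ σ : InfVolFermionState 2, σ.IsTranslationInvariant → σ.density = ω.density →
      κm * lo ≤ κm * σ.meanEnergy (hubbardTTPrimeFermionInteraction 1 t' U) 1)
    {ℓ uP δ q : ℝ} (hδ : 0 < δ) (hq : 0 ≤ q)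
    (hfloor : ∀ σ : InfVolFermionState 2, σ.IsTranslationInvariant → σ.density = ρ →
      ℓ ≤ σ.meanEnergy (hubbardTTPrimeSourcedInteraction 1 t' U 0 dWaveFormFactor h) 1)
    (hcapP : ∃ σ : InfVolFermionState 2, σ.IsTranslationInvariant ∧ σ.density = ρ + δ ∧
      σ.meanEnergy (hubbardTTPrimeSourcedInteraction 1 t' U 0 dWaveFormFactor h) 1 ≤ uP)
    {m : Type*} [Fintype m] [DecidableEq m] {Λm : Matrix m m ℂ} (hΛm : Λm.PosSemidef) (O : m → FermionOp Λ')
    {κ' : Type*} (s : Finset κ') (B : κ' → FermionOp Λ) (hB : ∀ k ∈ s, Commute (totalNumber : FermionOp Λ) (B k))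
    {ι : Type*} (tt : Finset ι) (γ : ι → DihedralGroup 4) (wv : ι → Site 2) (fl mt : ι → Fin 2)
    (hsh : ∀ l, d4ShiftSet (γ l) (wv l) Λ ⊆ Λ') (bb : ι → ℂ) (yw : ι → List (Orb (PolySite Λ) × Bool))
    {δ' : Type*} (ah : Finset δ') (dc : δ' → ℝ) (V : δ' → FermionOp Λ')
    {κ'' : Type*} (w : Finset κ'') (a : κ'' → ℂ) (word : κ'' → List (Orb (PolySite Λ') × Bool))
    {β : Type*} [Fintype β] [DecidableEq β] {G : Matrix β β ℂ} (hG : G.PosSemidef) (Bk : β → FermionOp Λ)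
    (hBk : ∀ b, Commute (totalNumber : FermionOp Λ) (Bk b))
    {β' : Type*} [Fintype β'] [DecidableEq β'] {G' : Matrix β' β' ℂ} (hG' : G'.PosSemidef) (Ck : β' → FermionOp Λ)
    (hCk : ∀ b, (totalNumber : FermionOp Λ) * Ck b - Ck b * totalNumber = -((q : ℂ) • Ck b)) {c : ℝ}
    (hcert : (fermionEmbed (PolySite.incl hP) (localPairAt (insert (0 : Site 2) unitSteps) dWaveFormFactor 0) +
          (fermionEmbed (PolySite.incl hP) (localPairAt (insert (0 : Site 2) unitSteps) dWaveFormFactor 0))ᴴ) -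
        (c : ℂ) • (1 : FermionOp Λ') -
        ∑ σ : Fin 2, ((μc σ : ℝ) : ℂ) • (nAt 0 hz σ - ((ν : ℝ) : ℂ) • (1 : FermionOp Λ')) -
        ((κp : ℝ) : ℂ) • (((u : ℝ) : ℂ) • (1 : FermionOp Λ') -
          fermionEmbed (PolySite.incl h0) ((hubbardTTPrimeSourcedInteraction 1 t' U 0 dWaveFormFactor h).meanEnergyObs 1)) -
        ((κm : ℝ) : ℂ) • (fermionEmbed (PolySite.incl h0) ((hubbardTTPrimeFermionInteraction 1 t' U).meanEnergyObs 1) -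
          ((lo : ℝ) : ℂ) • (1 : FermionOp Λ')) =
      gramForm Λm O +
        (∑ k ∈ s, (pairSourceWindowHamiltonianTT' dWaveFormFactor Λ' t' U 0 h * fermionEmbed (PolySite.incl hΛ) (B k) -
            fermionEmbed (PolySite.incl hΛ) (B k) * pairSourceWindowHamiltonianTT' dWaveFormFactor Λ' t' U 0 h) +
          ∑ l ∈ tt, bb l • (gaugePhase (twistFlipExp (γ l) (fl l) (mt l)) (yw l) •
              fermionEmbed (PolySite.incl (hsh l))
                (fermionEmbed (PolySite.d4Emb (γ l) (wv l) Λ) (spinSwapIter (fl l).val (ladderWord (yw l)))) -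
            fermionEmbed (PolySite.incl hΛ) (ladderWord (yw l)))) +
        (∑ m' ∈ ah, ((dc m' : ℝ) : ℂ) • ((V m')ᴴ - V m') + ∑ k ∈ w, a k • ladderWord (word k)) +
        kktForm (pairSourceWindowHamiltonianTT' dWaveFormFactor Λ' t' U 0 h) G
          (fun b' => fermionEmbed (PolySite.incl hΛ) (Bk b')) +
        (kktForm (pairSourceWindowHamiltonianTT' dWaveFormFactor Λ' t' U 0 h) G'
            (fun b' => fermionEmbed (PolySite.incl hΛ) (Ck b')) +
          ((q * ((uP - ℓ) / δ) : ℝ) : ℂ) • gramForm G' (fun b' => fermionEmbed (PolySite.incl hΛ) (Ck b')))) :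
    c - ∑ k ∈ w, ‖a k‖ + (∑ σ : Fin 2, μc σ) * (ω.density / 2 - ν) ≤
      2 * (ω.expect (pairRegion (insert (0 : Site 2) unitSteps) 0) (localPairAt (insert (0 : Site 2) unitSteps) dWaveFormFactor 0)).re := by
  have hmain := hω.re_sum_twistedFlipAct_expect_ge_of_sourced_certificate_kkt_canonical_chargeLowering hρ hρ0 hρ2 hmin hΛ h8 h0 hz _
    κp κm u lo μc ν hcap hlo hδ hq hfloor hcapP hΛm O s B hB tt γ wv fl mt hsh bb yw ah dc V w a word hG Bk hBk hG' Ck hCk hcert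
  simp_rw [re_expect_fermionEmbed_localPairAt_add_conjTranspose, ← Finset.mul_sum,
    ω.sum_re_expect_localPairAt_dWave_twistedFlipAct] at hmain
  linarith

end InfVolFermionState

end Literature.MathematicalPhysics.QuantumLattice

end
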